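import Mathlib
import HarnessLib
import Summits.HubbardSuperconductivity.HubbardSuperconductivity.Theorems.KLProgrammeKLRegimeSplitTwoLegTimeMomentFromGrid

/-!
# Route `KLProgramme` — ENGINE child 19918 (and its gen-6 successor), stub `stub_twoLeg_scale0`, (E3d)₀: the field strength does not see the
# counterterm, so the temporal grid moment of `W_{4M} − 𝒩_{K,4M}` (the element of the other three two-leg sums) is the one to export

Cell `gate-hubbard-kl`, seat p3 (g7).  The counterterm's self-energy is REAL and frequency-independent (`selfEnergy_counterQuadratic`:
`Σ_{𝒩_K}((ω,k⃗),σ) = K(p_{k⃗})`, p1b), so removing `𝒩_K` from a Grassmann element changes neither `Im Σ(ω₀) − Im Σ(−ω₀)` nor the field strength: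

* `fieldStrengthSpin_sub_counterQuadratic`, `fieldStrength_sub_counterQuadratic` — `z_{G − 𝒩_K} = z_G`;
* `klFieldStrength_zero_eq_fieldStrength_sub_counter` — `klFieldStrength … K 0 k⃗ = fieldStrength (𝒱^{(0)} − 𝒩_K) k⃗`;
* **`abs_klFieldStrength_zero_sub_one_le_of_grid_time_moment_sub_counter`** — `|klFieldStrength … K 0 k⃗ − 1| ≤ (2·4M/β)·Bᵗ` from the circular
  grid time moment of `kernel₂ (W_{4M} − 𝒩_{K,4M})` (the `Bᵗ` of `…EngineScaleZeroTwoLegGridSumsWeights.twoLeg_time_sum_le`), i.e. the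
  (E3d)₀ export keyed on the SAME grid element `W_{4M} − 𝒩_{K,4M}` as `B₀, B₁, B₂` (`twoLeg_sep_momentumSizes_zero_of_grid`).

Everything is PROVED; no definitions; nothing about the model is asserted.  References: BGM 2006 §2.1 (2.4)–(2.5), §2.4 (2.36)
[cite: BenfattoGiulianiMastropietro2006].
-/

noncomputable section

namespace Summit.HubbardSuperconductivity.HubbardSuperconductivity.Theorems.TwoLegFourier

set_option linter.dupNamespace false -- summit = problem name (single-conjunct summit), D-0017

open Finset Complex
open Literature.MathematicalPhysics.QuantumLattice Literature.Probability.LatticeModels GrassmannAlgebra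
open Summit.HubbardSuperconductivity.HubbardSuperconductivity.Theorems.KLRegimeSplit
open Summit.HubbardSuperconductivity.HubbardSuperconductivity.Theorems.KLProgrammeLegKernels

variable {L M : ℕ} [NeZero L] [NeZero M]

/-- **The field strength (per spin) does not see the counterterm**: `z_{G − 𝒩_K}(k⃗,σ) = z_G(k⃗,σ)` (`β ≠ 0`; the counterterm's self-energy
is the real number `K(p_{k⃗})` at both `±ω₀`). -/
theorem fieldStrengthSpin_sub_counterQuadratic {β : ℝ} (hβ : β ≠ 0) (G : HubbardGrassmann L M) (K : TrigPolyC4v) (k : TorusSite 2 L)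
    (σ : Fin 2) :
    fieldStrengthSpin L M β (G - counterQuadratic L M β K) k σ = fieldStrengthSpin L M β G k σ := by
  simp only [fieldStrengthSpin, selfEnergy_sub, selfEnergy_counterQuadratic hβ, Complex.sub_im, Complex.ofReal_im, sub_zero]

/-- **The spin-averaged field strength does not see the counterterm**: `z_{G − 𝒩_K}(k⃗) = z_G(k⃗)`. -/
theorem fieldStrength_sub_counterQuadratic {β : ℝ} (hβ : β ≠ 0) (G : HubbardGrassmann L M) (K : TrigPolyC4v) (k : TorusSite 2 L) :
    fieldStrength L M β (G - counterQuadratic L M β K) k = fieldStrength L M β G k := by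
  simp only [fieldStrength, fieldStrengthSpin_sub_counterQuadratic hβ]

/-- **`klFieldStrength … K 0 k⃗ = fieldStrength (𝒱^{(0)} − 𝒩_K) k⃗`.** -/
theorem klFieldStrength_zero_eq_fieldStrength_sub_counter {β : ℝ} (hβ : β ≠ 0) (U μ : ℝ) (K : TrigPolyC4v) (k : TorusSite 2 L) :
    klFieldStrength L M β U μ K 0 k = fieldStrength L M β (klEffectiveAction L M β U μ K klE0 0 - counterQuadratic L M β K) k := by
  rw [klFieldStrength, fieldStrength_sub_counterQuadratic hβ]

/-- **THE (E3d)₀ EXPORT KEYED ON `W_{4M} − 𝒩_{K,4M}`**: if for both spins and every grid point `p₀`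
`Σ_{p₁} (β/4M)·circDist_{4M}(j_{p₀}, j_{p₁})·‖kernel₂ (W_{4M} − 𝒩_{K,4M}) ((p₀,σ,+),(p₁,σ,−))‖ ≤ Bᵗ` (the bound `twoLeg_time_sum_le` delivers),
then `|klFieldStrength … K 0 k⃗ − 1| ≤ (2·4M/β)·Bᵗ` at every torus momentum. -/
theorem abs_klFieldStrength_zero_sub_one_le_of_grid_time_moment_sub_counter {β : ℝ} (hβ : 0 < β) (U μ : ℝ) (K : TrigPolyC4v)
    (k : TorusSite 2 L) {B : ℝ}
    (hB : ∀ (σ : Fin 2) (p₀ : GridPoint L (2 * (2 * M))), ∑ p₁ : GridPoint L (2 * (2 * M)),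
      β / ((2 * (2 * M) : ℕ) : ℝ) * (circDist (2 * (2 * M)) p₀.1.val p₁.1.val : ℝ) *
        ‖kernel ℂ
          (effAction ℂ ((hubbardGridSub L M β (2 * (2 * M))).transpose * hubbardCovAboveCT L M β μ 0 K klE0 *
              hubbardGridSub L M β (2 * (2 * M)))
            (hubbardGridInteraction L (2 * (2 * M)) β U + hubbardGridCounterQuadratic L (2 * (2 * M)) β K) -
            hubbardGridCounterQuadratic L (2 * (2 * M)) β K) 2
          (fun i => ((![p₀, p₁] i, σ), i))‖ ≤ B) :
    |klFieldStrength L M β U μ K 0 k - 1| ≤ 2 * ((2 * (2 * M) : ℕ) : ℝ) / β * B := by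
  haveI : NeZero (2 * (2 * M) : ℕ) := ⟨by have := NeZero.ne M; omega⟩
  rw [klFieldStrength_zero_eq_fieldStrength_sub_counter hβ.ne' U μ K, klEffectiveAction_zero_sub_counterQuadratic_eq_map_gridSub hβ.ne' U μ K]
  exact abs_fieldStrength_sub_one_map_gridSub_le_of_time_moment hβ _ _ k hB

end Summit.HubbardSuperconductivity.HubbardSuperconductivity.Theorems.TwoLegFourier

end
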